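import Summits.BirchSwinnertonDyer.Rank1Residual.X2.DualRestriction
import Summits.BirchSwinnertonDyer.Rank1Residual.X2.DualRestrictionInvariants
import Summits.BirchSwinnertonDyer.Rank1Residual.X2.NonPrimitiveSelmerCorank
import Summits.BirchSwinnertonDyer.Rank1Residual.X2.SelmerCotorsionOfFiniteTorsion
import Literature.NumberTheory.EllipticCurves.GreenbergVatsal2000.NonPrimitiveDatumSelmerInvariants
import Literature.NumberTheory.EllipticCurves.IwasawaNakayamaProofs
import Literature.NumberTheory.EllipticCurves.IwasawaLeadingTermProofs
import HarnessLib

/-!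
# The dual of `S^{Σ₀}_A(K_∞)` over the dual of a conjugation-stable SUBGROUP `T ⊆ S^{Σ₀}_A(K_∞)`:
# `0 → Hom(S/T, ℚ/ℤ) → X(S) → X(T) → 0` and its Iwasawa invariants

HONEST FRAMING (BSD rank-`≤ 1` residual cell `b2b-bsdres`, home
`run/shared/lean/b2b/bsd-rank1-residual/`, unit `b2b-bsdres-eisenstein-p2`, class X2; research route,
no claim beyond stated classes): the cell deletes the COMBINATION-SHAPED residual classes of the
rank-`≤ 1` BSD formula from PUBLISHED theorems only and TYPES the construction-shaped ones; this is
not "finishing BSD". THEOREMS ONLY (no definition, no named fact, nothing asserted).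

## What

`S = S^{S₀}_A(K_∞) = datumSelmerInfty κ A L S₀` (`A = E[p^∞]`, GV §2), with its canonical
Pontryagin dual `X(S) = Hom(S, ℚ/ℤ)` (`GreenbergVatsal2000.datumDualData`, `T = conj_γ − 1`), and a
subgroup `T ⊆ S` stable under `conj_γ` with ANY dual data `(X_T, toDual_T)` in the tree's shape (for
the X2 lineage: `T` = the classical `Sel^{Σ₀}_E(ℚ_∞)_p = S^{Σ₀,str}_A`, the STRICT group at a split
multiplicative prime, GV pp. 14–15, and `X_T` = a `NonPrimitiveDualData` / `SelmerDualData`). Then: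

* §1 `exists_restrictionMap` — a `Λ`-linear SURJECTION `π : X(S) ↠ X_T`, `toDual_T (π x) = x|_T`,
  with `π x = 0 ↔ x|_T = 0` (`DualRestriction.exists_restrict_surjective`);
* §2 `nonempty_ker_addEquiv_characterModule` — `ker π ≃ Hom(S/T, ℚ/ℤ)` as groups;
* §3 `invariants_of_restrictionMap` — if `X(S)` is finitely generated and torsion and `(S/T)[p]` is
  finite: `X_T` is finitely generated and torsion, **`μ(X(S)) = μ(X_T)`** and
  **`λ(X(S)) = λ(X_T) + corank_{ℤ_p}(S/T)`** (`ker π` is finitely generated with `ker/p` finite, hence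
  torsion with `μ = 0` and `λ = corank_{ℤ_p}(S/T)` — `isTorsion_of_finite_modN`,
  `muInvariant_eq_zero_of_finite_modN`, `finite_torsionBy_and_zpCorank_eq_lambdaInvariant`; then
  `DualRestrictionInvariants`); `isTorsion_of_restrictionMap` — conversely `X(S)` is torsion when
  `X_T` is (and `X(S)` is finitely generated);
* §4 `moduleFinite_datumDualData_of_finite` — **Nakayama**: `X(S)` is finitely generated as soon as
  `T[𝔪] = {t ∈ T : p t = 0, conj_γ t = t}` and `(S/T)[p]` are finite (`IsDualPair.module_finite`).

References: R. Greenberg, LNM 1716 (1999) §1 p. 60; GV 2000 §2 pp. 14–17; L. Washington §13.2.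
-/

noncomputable section

open scoped Classical AddSubgroup

universe u v

namespace Summit.BirchSwinnertonDyer.Rank1Residual.X2.DualRestrictionSelmer

open NumberField IsDedekindDomain Field WeierstrassCurve
  Literature.NumberTheory.EllipticCurves Literature.NumberTheory.EllipticCurves.GreenbergSelmer
  Literature.NumberTheory.EllipticCurves.GreenbergVatsal2000
  Literature.NumberTheory.EllipticCurves.IwasawaDual
  Literature.NumberTheory.GaloisRepresentations
  Summit.BirchSwinnertonDyer.Rank1Residual.X2.DualRestriction
  Summit.BirchSwinnertonDyer.Rank1Residual.X2.DualRestrictionInvariants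

variable {K : Type u} [Field K] [NumberField K] (W : WeierstrassCurve K) {p : ℕ} [hp : Fact p.Prime]
  (κ : ZpExtension K p) {γ : absoluteGaloisGroup K} (hγ : κ.IsTopGenerator γ)
  (L : Data K (W.geomPrimaryTorsion p) p) (S₀ : Set (HeightOneSpectrum (𝓞 K)))
  {T : AddSubgroup (subgroupH1 κ.kerSubgroup (W.geomPrimaryTorsion p))}
  (hTS : T ≤ datumSelmerInfty κ (W.geomPrimaryTorsion p) L S₀)
  (φT : AddMonoid.End T)
  (hφT : ∀ t : T, ((φT t : T) : subgroupH1 κ.kerSubgroup (W.geomPrimaryTorsion p)) =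
    conjH1 κ.kerSubgroup (W.geomPrimaryTorsion p) γ t)
  (hT : IsLocNil p (φT - 1))
  {XT : Type v} [AddCommGroup XT] [Module (IwasawaAlgebra p) XT]
  (dT : XT →+ (T →+ AddCircle (1 : ℚ))) (hbT : Function.Bijective dT)
  (hTT : ∀ (y : XT) (t : T), dT ((PowerSeries.X : IwasawaAlgebra p) • y) t = dT y (φT t) - dT y t)
  (hCT : ∀ (c : ℤ_[p]) (y : XT) (t : T) (k : ℕ), (p ^ k) • t = 0 →
    dT (PowerSeries.C c • y) t = (PadicInt.toZModPow k c).val • dT y t)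

/-! ## §1. The restriction map `X(S) ↠ X_T` -/

/-- Unfolding `conjDatum` on coercions (the tree's lemma of the same content is private).
[folklore] -/
theorem coe_conjDatum_apply' (γ : absoluteGaloisGroup K)
    (s : datumSelmerInfty κ (W.geomPrimaryTorsion p) L S₀) :
    ((conjDatum W κ L S₀ γ s : datumSelmerInfty κ (W.geomPrimaryTorsion p) L S₀) :
        subgroupH1 κ.kerSubgroup (W.geomPrimaryTorsion p)) = conjH1 κ.kerSubgroup (W.geomPrimaryTorsion p) γ s :=
  rfl

include hφT in
/-- `conj_γ` on `S^{S₀}_A(K_∞)` and on `T` are intertwined by the inclusion `T ⊆ S`. [folklore] -/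
theorem conjDatum_inclusion (t : T) :
    conjDatum W κ L S₀ γ (AddSubgroup.inclusion hTS t) = AddSubgroup.inclusion hTS (φT t) := by
  apply Subtype.ext
  rw [coe_conjDatum_apply', AddSubgroup.coe_inclusion, AddSubgroup.coe_inclusion, hφT]

include hφT hT hbT hTT hCT in
/-- **The restriction map.** There is a `Λ`-linear SURJECTION `π` from the canonical dual
`X(S) = Hom(S^{S₀}_A(K_∞), ℚ/ℤ)` (`datumDualData`) onto any dual datum `X_T` of a `conj_γ`-stable
subgroup `T ⊆ S^{S₀}_A(K_∞)`, reading `toDual_T (π x) = x|_T`, with `π x = 0 ↔ x|_T = 0`.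
[cite: GreenbergLNM1716, §1 p. 60] [cite: GreenbergVatsal2000, §2 pp. 14–17] -/
theorem exists_restrictionMap :
    ∃ π : (datumDualData W κ L S₀ hγ).X →ₗ[IwasawaAlgebra p] XT, Function.Surjective π ∧
      (∀ x, dT (π x) = ((datumDualData W κ L S₀ hγ).toDual x).comp (AddSubgroup.inclusion hTS)) ∧
      ∀ x, π x = 0 ↔ ((datumDualData W κ L S₀ hγ).toDual x).comp (AddSubgroup.inclusion hTS) = 0 := by
  have hS := isLocNil_conjDatum_sub_one W κ L S₀ hγ
  have hTS' : ∀ (x : (datumDualData W κ L S₀ hγ).X)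
      (s : datumSelmerInfty κ (W.geomPrimaryTorsion p) L S₀),
      (datumDualData W κ L S₀ hγ).toDual ((PowerSeries.X : IwasawaAlgebra p) • x) s =
        (datumDualData W κ L S₀ hγ).toDual x (conjDatum W κ L S₀ γ s) -
          (datumDualData W κ L S₀ hγ).toDual x s :=
    fun x s ↦ (datumDualData W κ L S₀ hγ).toDual_T_smul x s
  exact exists_restrict_surjective (conjDatum W κ L S₀ γ) φT hS hT
    (datumDualData W κ L S₀ hγ).toDual dT (datumDualData W κ L S₀ hγ).bijective hbT hTS'
    (datumDualData W κ L S₀ hγ).toDual_C_smul hTT hCT (AddSubgroup.inclusion hTS)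
    (conjDatum_inclusion W κ L S₀ hTS φT hφT) (AddSubgroup.inclusion_injective hTS)

/-! ## §2. The kernel is `Hom(S/T, ℚ/ℤ)` -/

/-- **`ker π ≅ Hom(S/T, ℚ/ℤ)`** (as groups): a character of `S` vanishing on `T` is a character of
`S/T` (`QuotientAddGroup.lift`), and conversely (composition with the projection). [folklore] -/
theorem nonempty_ker_addEquiv_characterModule
    (π : (datumDualData W κ L S₀ hγ).X →ₗ[IwasawaAlgebra p] XT)
    (hker : ∀ x, π x = 0 ↔
      ((datumDualData W κ L S₀ hγ).toDual x).comp (AddSubgroup.inclusion hTS) = 0) :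
    Nonempty (LinearMap.ker π ≃+
      ((datumSelmerInfty κ (W.geomPrimaryTorsion p) L S₀ ⧸
        T.addSubgroupOf (datumSelmerInfty κ (W.geomPrimaryTorsion p) L S₀)) →+ AddCircle (1 : ℚ))) := by
  -- a character in the kernel vanishes on `N`
  have hvan : ∀ x : LinearMap.ker π, (T.addSubgroupOf (datumSelmerInfty κ (W.geomPrimaryTorsion p) L S₀)) ≤ ((datumDualData W κ L S₀ hγ).toDual x.1).ker := by
    intro x s hs
    rw [AddMonoidHom.mem_ker]
    have hx := (hker x.1).mp (LinearMap.mem_ker.mp x.2)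
    have h1 : (datumDualData W κ L S₀ hγ).toDual x.1 s =
        (((datumDualData W κ L S₀ hγ).toDual x.1).comp (AddSubgroup.inclusion hTS)) ⟨s, hs⟩ := rfl
    rw [h1, hx, AddMonoidHom.zero_apply]
  -- the forward map
  let F : LinearMap.ker π →+ ((datumSelmerInfty κ (W.geomPrimaryTorsion p) L S₀) ⧸ (T.addSubgroupOf (datumSelmerInfty κ (W.geomPrimaryTorsion p) L S₀)) →+ AddCircle (1 : ℚ)) :=
    AddMonoidHom.mk' (fun x ↦ QuotientAddGroup.lift (T.addSubgroupOf (datumSelmerInfty κ (W.geomPrimaryTorsion p) L S₀)) ((datumDualData W κ L S₀ hγ).toDual x.1)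
      (hvan x)) fun x y ↦ by
      -- `ext` on maps out of a quotient compares the pull-backs to `S`
      ext s
      simp only [AddMonoidHom.comp_apply, AddMonoidHom.add_apply, QuotientAddGroup.mk'_apply,
        QuotientAddGroup.lift_mk, Submodule.coe_add, map_add]
  have hF : ∀ (x : LinearMap.ker π) (s : (datumSelmerInfty κ (W.geomPrimaryTorsion p) L S₀)),
      F x (s : (datumSelmerInfty κ (W.geomPrimaryTorsion p) L S₀) ⧸ (T.addSubgroupOf (datumSelmerInfty κ (W.geomPrimaryTorsion p) L S₀))) = (datumDualData W κ L S₀ hγ).toDual x.1 s := fun x s ↦ by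
    show QuotientAddGroup.lift (T.addSubgroupOf (datumSelmerInfty κ (W.geomPrimaryTorsion p) L S₀)) ((datumDualData W κ L S₀ hγ).toDual x.1) (hvan x) (s : (datumSelmerInfty κ (W.geomPrimaryTorsion p) L S₀) ⧸ (T.addSubgroupOf (datumSelmerInfty κ (W.geomPrimaryTorsion p) L S₀))) = _
    rw [QuotientAddGroup.lift_mk]
  have hinj : Function.Injective F := by
    intro x y hxy
    apply Subtype.ext
    apply (datumDualData W κ L S₀ hγ).bijective.1
    ext s
    have h := DFunLike.congr_fun hxy
      (s : (datumSelmerInfty κ (W.geomPrimaryTorsion p) L S₀) ⧸ (T.addSubgroupOf (datumSelmerInfty κ (W.geomPrimaryTorsion p) L S₀)))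
    rwa [hF, hF] at h
  have hsurj : Function.Surjective F := by
    intro χ
    -- the character `χ ∘ (S → S/T)` of `S` (the dual datum is `Hom(S, ℚ/ℤ)` itself, `toDual = id`)
    obtain ⟨x, hx⟩ := (datumDualData W κ L S₀ hγ).bijective.2
      (χ.comp (QuotientAddGroup.mk' (T.addSubgroupOf (datumSelmerInfty κ (W.geomPrimaryTorsion p) L S₀))))
    have hxK : x ∈ LinearMap.ker π := by
      rw [LinearMap.mem_ker, hker, hx]
      ext t
      have ht0 : QuotientAddGroup.mk' (T.addSubgroupOf (datumSelmerInfty κ (W.geomPrimaryTorsion p) L S₀))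
          (AddSubgroup.inclusion hTS t) = 0 := by
        rw [QuotientAddGroup.mk'_apply, QuotientAddGroup.eq_zero_iff, AddSubgroup.mem_addSubgroupOf,
          AddSubgroup.coe_inclusion]
        exact t.2
      rw [AddMonoidHom.comp_apply, AddMonoidHom.comp_apply, ht0, map_zero, AddMonoidHom.zero_apply]
    refine ⟨⟨x, hxK⟩, ?_⟩
    ext s
    have hF' : F ⟨x, hxK⟩
        (s : (datumSelmerInfty κ (W.geomPrimaryTorsion p) L S₀) ⧸ (T.addSubgroupOf (datumSelmerInfty κ (W.geomPrimaryTorsion p) L S₀))) =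
        (datumDualData W κ L S₀ hγ).toDual x s := hF ⟨x, hxK⟩ s
    rw [AddMonoidHom.comp_apply, AddMonoidHom.comp_apply, QuotientAddGroup.mk'_apply, hF', hx,
      AddMonoidHom.comp_apply, QuotientAddGroup.mk'_apply]
  exact ⟨AddEquiv.ofBijective F ⟨hinj, hsurj⟩⟩

/-! ## §3. Invariants across the restriction map -/

/-- `S^{S₀}_A(K_∞)/T` is `p`-primary (classes of `H¹(K_∞, E[p^∞])` are killed by powers of `p`).
[cite: GreenbergLNM1716, §1 p. 60] -/
theorem isPrimary_quotient
    (q : datumSelmerInfty κ (W.geomPrimaryTorsion p) L S₀ ⧸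
      T.addSubgroupOf (datumSelmerInfty κ (W.geomPrimaryTorsion p) L S₀)) :
    ∃ n : ℕ, p ^ n • q = 0 := by
  induction q using QuotientAddGroup.induction_on with
  | H s =>
    obtain ⟨n, hn⟩ := W.exists_pow_smul_subgroupH1_ker_eq_zero κ (s : subgroupH1 κ.kerSubgroup (W.geomPrimaryTorsion p))
    refine ⟨n, ?_⟩
    have hs : p ^ n • s = 0 := Subtype.ext (by rw [AddSubgroupClass.coe_nsmul]; exact hn)
    rw [← QuotientAddGroup.mk_nsmul, hs, QuotientAddGroup.mk_zero]

include hTS hφT hT hbT hTT hCT in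
/-- **Invariants across `X(S) ↠ X_T`.** If the canonical dual `X(S)` of `S = S^{S₀}_A(K_∞)` is
finitely generated and torsion and `(S/T)[p]` is finite, then for ANY dual datum `X_T` of the
`conj_γ`-stable subgroup `T ⊆ S`: `X_T` is finitely generated and torsion, `μ(X(S)) = μ(X_T)`, and
`λ(X(S)) = λ(X_T) + corank_{ℤ_p}(S/T)`. (Kernel `= Hom(S/T, ℚ/ℤ)`: finitely generated as a submodule,
`ker/p` finite, hence torsion with `μ = 0` and `λ = corank_{ℤ_p}(S/T)`.) GV pp. 14–15 use this
with `T = Sel_E(ℚ_∞)_p = S^{str}_A(ℚ_∞)` at a split multiplicative prime.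
[cite: GreenbergVatsal2000, §2 pp. 14–17] [cite: GreenbergLNM1716, §1 p. 60] -/
theorem invariants_of_restrictionMap [Module.Finite (IwasawaAlgebra p) (datumDualData W κ L S₀ hγ).X]
    (hX : Module.IsTorsion (IwasawaAlgebra p) (datumDualData W κ L S₀ hγ).X)
    [Finite ((datumSelmerInfty κ (W.geomPrimaryTorsion p) L S₀ ⧸
      T.addSubgroupOf (datumSelmerInfty κ (W.geomPrimaryTorsion p) L S₀))[(p : ℤ)])] :
    Module.Finite (IwasawaAlgebra p) XT ∧ Module.IsTorsion (IwasawaAlgebra p) XT ∧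
      muInvariant p (datumDualData W κ L S₀ hγ).X = muInvariant p XT ∧
      lambdaInvariant p (datumDualData W κ L S₀ hγ).X = lambdaInvariant p XT +
        zpCorank (datumSelmerInfty κ (W.geomPrimaryTorsion p) L S₀ ⧸
          T.addSubgroupOf (datumSelmerInfty κ (W.geomPrimaryTorsion p) L S₀)) p := by
  obtain ⟨π, hsurj, -, hker⟩ :=
    exists_restrictionMap W κ hγ L S₀ hTS φT hφT hT dT hbT hTT hCT
  obtain ⟨Ψ₀⟩ := nonempty_ker_addEquiv_characterModule W κ hγ L S₀ hTS π hker
  let Ψ : LinearMap.ker π ≃+ CharacterModule (datumSelmerInfty κ (W.geomPrimaryTorsion p) L S₀ ⧸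
      T.addSubgroupOf (datumSelmerInfty κ (W.geomPrimaryTorsion p) L S₀)) := Ψ₀
  -- the kernel: finitely generated, `ker/p` finite, torsion, `μ = 0`, `λ = corank`
  haveI : IsNoetherian (IwasawaAlgebra p) (datumDualData W κ L S₀ hγ).X := inferInstance
  haveI hKfg : Module.Finite (IwasawaAlgebra p) (LinearMap.ker π) :=
    Module.Finite.iff_fg.mpr (IsNoetherian.noetherian (LinearMap.ker π))
  haveI : Finite (ModN (CharacterModule (datumSelmerInfty κ (W.geomPrimaryTorsion p) L S₀ ⧸
      T.addSubgroupOf (datumSelmerInfty κ (W.geomPrimaryTorsion p) L S₀))) p) :=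
    MuTransferDerived.finite_modN_characterModule_of_finite_torsionBy p
  haveI hKmod : Finite (ModN (LinearMap.ker π) p) := Finite.of_equiv _ (modNEquiv Ψ p).symm.toEquiv
  have hKt : Module.IsTorsion (IwasawaAlgebra p) (LinearMap.ker π) :=
    SelmerCotorsionOfFiniteTorsion.isTorsion_of_finite_modN p (LinearMap.ker π)
  have hKmu : muInvariant p (LinearMap.ker π) = 0 :=
    MuVanishingOfFiniteModP.muInvariant_eq_zero_of_finite_modN p (LinearMap.ker π) hKt
  have hKlam : zpCorank (datumSelmerInfty κ (W.geomPrimaryTorsion p) L S₀ ⧸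
      T.addSubgroupOf (datumSelmerInfty κ (W.geomPrimaryTorsion p) L S₀)) p =
        lambdaInvariant p (LinearMap.ker π) :=
    (NonPrimitiveSelmerCorank.finite_torsionBy_and_zpCorank_eq_lambdaInvariant p (LinearMap.ker π)
      hKt hKmu (isPrimary_quotient W κ L S₀) Ψ).2
  -- the target
  haveI hXT : Module.Finite (IwasawaAlgebra p) XT := Module.Finite.of_surjective π hsurj
  refine ⟨hXT, isTorsion_of_surjective π hsurj hX, ?_, ?_⟩
  · rw [muInvariant_eq_add_of_surjective p π hX hsurj, hKmu, zero_add]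
  · rw [lambdaInvariant_eq_add_of_surjective p π hX hsurj, hKlam, add_comm]

include hTS hφT hT hbT hTT hCT in
/-- **Conversely, `X(S)` is torsion when `X_T` is** (and `X(S)` is finitely generated, `(S/T)[p]`
finite): an extension of the torsion module `X_T` by the torsion kernel `Hom(S/T, ℚ/ℤ)`.
[cite: GreenbergVatsal2000, §2 pp. 14–17] -/
theorem isTorsion_of_restrictionMap [Module.Finite (IwasawaAlgebra p) (datumDualData W κ L S₀ hγ).X]
    (hXT : Module.IsTorsion (IwasawaAlgebra p) XT)
    [Finite ((datumSelmerInfty κ (W.geomPrimaryTorsion p) L S₀ ⧸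
      T.addSubgroupOf (datumSelmerInfty κ (W.geomPrimaryTorsion p) L S₀))[(p : ℤ)])] :
    Module.IsTorsion (IwasawaAlgebra p) (datumDualData W κ L S₀ hγ).X := by
  obtain ⟨π, -, -, hker⟩ :=
    exists_restrictionMap W κ hγ L S₀ hTS φT hφT hT dT hbT hTT hCT
  obtain ⟨Ψ₀⟩ := nonempty_ker_addEquiv_characterModule W κ hγ L S₀ hTS π hker
  let Ψ : LinearMap.ker π ≃+ CharacterModule (datumSelmerInfty κ (W.geomPrimaryTorsion p) L S₀ ⧸
      T.addSubgroupOf (datumSelmerInfty κ (W.geomPrimaryTorsion p) L S₀)) := Ψ₀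
  haveI : IsNoetherian (IwasawaAlgebra p) (datumDualData W κ L S₀ hγ).X := inferInstance
  haveI hKfg : Module.Finite (IwasawaAlgebra p) (LinearMap.ker π) :=
    Module.Finite.iff_fg.mpr (IsNoetherian.noetherian (LinearMap.ker π))
  haveI : Finite (ModN (CharacterModule (datumSelmerInfty κ (W.geomPrimaryTorsion p) L S₀ ⧸
      T.addSubgroupOf (datumSelmerInfty κ (W.geomPrimaryTorsion p) L S₀))) p) :=
    MuTransferDerived.finite_modN_characterModule_of_finite_torsionBy p
  haveI hKmod : Finite (ModN (LinearMap.ker π) p) := Finite.of_equiv _ (modNEquiv Ψ p).symm.toEquiv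
  have hKt : Module.IsTorsion (IwasawaAlgebra p) (LinearMap.ker π) :=
    SelmerCotorsionOfFiniteTorsion.isTorsion_of_finite_modN p (LinearMap.ker π)
  exact isTorsion_of_surjective_of_ker p π hKt hXT

/-! ## §4. Nakayama: `X(S)` is finitely generated when `T[𝔪]` and `(S/T)[p]` are finite -/

include hTS hφT in
/-- **`X(S^{S₀}_A(K_∞))` is finitely generated** as soon as `T[𝔪] = {t ∈ T : p t = 0, conj_γ t = t}`
is finite and `(S/T)[p]` is finite, for a `conj_γ`-stable `T ⊆ S` (dual Nakayama lemma,
`IwasawaDual.IsDualPair.module_finite`: `S[𝔪] → (S/T)[p]` has fibres translates of `T[𝔪]`).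
Greenberg LNM 1716 §1 p. 60 ("By a version of Nakayama's Lemma …").
[cite: GreenbergLNM1716, §1 p. 60 (after Conj. 1.3)] -/
theorem moduleFinite_datumDualData_of_finite
    (hfinT : Set.Finite {t : T | p • t = 0 ∧ φT t = t})
    [Finite ((datumSelmerInfty κ (W.geomPrimaryTorsion p) L S₀ ⧸
      T.addSubgroupOf (datumSelmerInfty κ (W.geomPrimaryTorsion p) L S₀))[(p : ℤ)])] :
    Module.Finite (IwasawaAlgebra p) (datumDualData W κ L S₀ hγ).X := by
  set S := datumSelmerInfty κ (W.geomPrimaryTorsion p) L S₀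
  set N : AddSubgroup S := T.addSubgroupOf S
  have hpair : IsDualPair p (conjDatum W κ L S₀ γ - 1) (datumDualData W κ L S₀ hγ).toDual :=
    { bijective := (datumDualData W κ L S₀ hγ).bijective
      T_smul := fun x s ↦ by
        rw [(datumDualData W κ L S₀ hγ).toDual_T_smul, IwasawaDual.End_sub_apply,
          AddMonoid.End.one_apply, map_sub]
        rfl
      C_smul := fun c x s k hk ↦ (datumDualData W κ L S₀ hγ).toDual_C_smul c x s k hk
      locNil := isLocNil_conjDatum_sub_one W κ L S₀ hγ }
  refine hpair.module_finite ?_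
  -- `S[𝔪] → S/T`, `s ↦ s mod T`: finite image (inside `(S/T)[p]`) and finite fibres (`T[𝔪]`-cosets)
  let f : S → S ⧸ N := fun s ↦ (s : S ⧸ N)
  have hP : ∀ s : S, s ∈ ((piece p (conjDatum W κ L S₀ γ - 1) 1 : AddSubgroup S) : Set S) ↔
      p • s = 0 ∧ conjDatum W κ L S₀ γ s = s := by
    intro s
    rw [SetLike.mem_coe, mem_piece, pow_one, pow_one, IwasawaDual.End_sub_apply,
      AddMonoid.End.one_apply, sub_eq_zero]
  apply Set.Finite.of_finite_fibers f
  · -- the image lies in the finite group `(S/T)[p]`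
    have hfin : Set.Finite (((S ⧸ N)[(p : ℤ)] : AddSubgroup (S ⧸ N)) : Set (S ⧸ N)) :=
      Set.toFinite _
    refine hfin.subset ?_
    rintro _ ⟨s, hs, rfl⟩
    rw [SetLike.mem_coe, mem_torsionBy_iff, natCast_zsmul]
    show p • (s : S ⧸ N) = 0
    rw [← QuotientAddGroup.mk_nsmul, ((hP s).mp hs).1, QuotientAddGroup.mk_zero]
  · -- the fibre through `s₀` is `{t + s₀ : t ∈ T[𝔪]}`
    rintro _ ⟨s₀, hs₀, rfl⟩
    obtain ⟨h01, h02⟩ := (hP s₀).mp hs₀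
    refine (hfinT.image fun t : T ↦
      (⟨(t : subgroupH1 κ.kerSubgroup (W.geomPrimaryTorsion p)) + s₀, add_mem (hTS t.2) s₀.2⟩ : S)).subset ?_
    rintro s ⟨hs, hsf⟩
    obtain ⟨hs1, hs2⟩ := (hP s).mp hs
    have hsf' : (s : S ⧸ N) = (s₀ : S ⧸ N) := hsf
    have hdiff : (s : subgroupH1 κ.kerSubgroup (W.geomPrimaryTorsion p)) - s₀ ∈ T := by
      rw [QuotientAddGroup.eq_iff_sub_mem, AddSubgroup.mem_addSubgroupOf, AddSubgroupClass.coe_sub]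
        at hsf'
      exact hsf'
    refine ⟨⟨_, hdiff⟩, ⟨Subtype.ext ?_, Subtype.ext ?_⟩, Subtype.ext ?_⟩
    · show p • ((s : subgroupH1 κ.kerSubgroup (W.geomPrimaryTorsion p)) - s₀) = 0
      rw [smul_sub, ← AddSubgroupClass.coe_nsmul, ← AddSubgroupClass.coe_nsmul, hs1, h01, sub_self]
    · rw [hφT]
      show conjH1 κ.kerSubgroup (W.geomPrimaryTorsion p) γ ((s : subgroupH1 κ.kerSubgroup (W.geomPrimaryTorsion p)) - s₀) =
        (s : subgroupH1 κ.kerSubgroup (W.geomPrimaryTorsion p)) - s₀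
      have e1 := congrArg (fun z : S ↦ (z : subgroupH1 κ.kerSubgroup (W.geomPrimaryTorsion p))) hs2
      have e2 := congrArg (fun z : S ↦ (z : subgroupH1 κ.kerSubgroup (W.geomPrimaryTorsion p))) h02
      simp only [coe_conjDatum_apply'] at e1 e2
      rw [map_sub, e1, e2]
    · show ((s : subgroupH1 κ.kerSubgroup (W.geomPrimaryTorsion p)) - s₀) + s₀ = s
      rw [sub_add_cancel]

end Summit.BirchSwinnertonDyer.Rank1Residual.X2.DualRestrictionSelmer

end
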